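import Summits.QuantumFields.YangMills.Theses.SquareRootCeilings
import Summits.QuantumFields.YangMills.Theorems.LangevinControlUVOSLegsFromFemtoAndGapStubCollar6
import Summits.QuantumFields.YangMills.Theorems.BalabanLadderNTCumulantPolarisationDefs
import Summits.QuantumFields.YangMills.Theorems.BalabanLadderUVSeamRecResponseMomentsPinning

/-!
# Route `SquareRootCeilings` (ym-idea-11 g3): `DominationTransfer` is bookkeeping

Item stmt-QuantumFields-26672 `DominationTransfer : SubOnsetTwoPointCeilings → SqrtDomination → (antecedent of
TypicalExteriorCeilings.FactorialCalibration)`, proved: K1 (`SubOnsetTwoPointCeilings`) supplies ONE uniform bound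
`b := (C₁/R⁴)²` on every `(2R+4)`-separated single-plane two-point function at sub-onset resolution, K2
(`SqrtDomination`, uniform-envelope form of rev 2) turns it into `|E ∏ᵢ(Pᵢ − EPᵢ)| ≤ (C₂ n^θ √b)ⁿ = (C₂C₁ n^θ/R⁴)ⁿ`
for `n ≥ 2`; `n = 0` (empty product, `E 1 = 1`, tree lemma `ResponsePinning.torusE_const`) and `n = 1` (a centred one-point function vanishes) are trivial.
No crux is touched and no summit, leg or leaf is proved by this file.
-/

set_option autoImplicit false

namespace Summit.QuantumFields.YangMills.Theses.SquareRootCeilings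

open MeasureTheory
open Literature.MathematicalPhysics.QuantumFieldTheory Literature.MathematicalPhysics.QuantumLattice
open Summit.QuantumFields.YangMills.Cruxes.OSLegsFromFemtoAndGap.DlrCollarTransfer

section Aux

variable (G : Type) [Group G] [TopologicalSpace G] [IsTopologicalGroup G] [CompactSpace G]
  [MeasurableSpace G] [BorelSpace G] (r : LatticeRep G)

/-- A centred single-plane one-point function vanishes. -/
theorem torusE_plane_centred (β : ℝ) (L : ℕ) (q : Fin 4 × Fin 4) (x : Fin 4 → ℤ) :
    torusE G r β L (fun U => plane G r q x U - torusE G r β L (plane G r q x)) = 0 := by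
  rw [Summit.QuantumFields.YangMills.Cruxes.NT.CumulantPolarisation.torusE_sub G r β L (continuous_plane r q x)
    continuous_const, Summit.QuantumFields.YangMills.Cruxes.UVSeamRec.ResponsePinning.torusE_const, sub_self]

end Aux

/-- item stmt-QuantumFields-26672 (`DominationTransfer`) of route `SquareRootCeilings`. -/
theorem dominationTransfer_proof : DominationTransfer := by
  intro hK1 hK2 G _ _ _ _ hG hSU
  letI : MeasurableSpace G := borel G
  haveI : BorelSpace G := ⟨rfl⟩
  intro r v f g h Λ₅
  obtain ⟨ε₀, hε₀, H1⟩ := hK1 G hG hSU r v f g h Λ₅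
  refine ⟨ε₀, hε₀, fun ε hε hεle hfl => ?_⟩
  obtain ⟨C₁, ℓ₄, β₄, hℓ₄, hC₁, H1'⟩ := H1 ε hε hεle hfl
  obtain ⟨C₂, θ, β₄', hC₂, hθ, H2⟩ := hK2 G hG hSU r
  refine ⟨C₂ * C₁, θ, ℓ₄, max β₄ β₄', hℓ₄, mul_nonneg hC₂ hC₁, hθ, ?_⟩
  intro β hβ s hs hs1 hsub L n
  have hβ₁ : β₄ ≤ β := le_trans (le_max_left _ _) hβ
  have hβ₂ : β₄' ≤ β := le_trans (le_max_right _ _) hβ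
  rcases n with _ | _ | m
  · -- n = 0 : empty product
    intro q x R _ _ _ _ _
    simp [Summit.QuantumFields.YangMills.Cruxes.UVSeamRec.ResponsePinning.torusE_const]
  · -- n = 1 : a centred one-point function vanishes
    intro q x R _ _ _ _ _
    have h0 : (0 : ℝ) ≤ (C₂ * C₁ * (((0 + 1 : ℕ) : ℝ)) ^ θ / (R : ℝ) ^ 4) ^ (0 + 1) := by positivity
    simpa [Fin.prod_univ_one, torusE_plane_centred] using h0
  · -- n = m + 2 ≥ 2 : K1 gives the uniform envelope, K2 the square-root gain
    intro q x R hq hR hRs hRL hsep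
    set b : ℝ := (C₁ / (R : ℝ) ^ 4) ^ 2 with hb
    have hb0 : 0 ≤ b := sq_nonneg _
    have hpairs : ∀ (q q' : Fin 4 × Fin 4) (x y : Fin 4 → ℤ), q.1 < q.2 → q'.1 < q'.2 →
        (∃ k : Fin 4, (2 * (R : ℤ) + 4) ≤ |((((x k - y k : ℤ) : ZMod (2 * L + 1))).valMinAbs : ℤ)|) →
        |torusE G r β L (fun U => (plane G r q x U - torusE G r β L (plane G r q x)) *
          (plane G r q' y U - torusE G r β L (plane G r q' y)))| ≤ b :=
      fun q q' x y hq hq' hk => H1' β hβ₁ s hs hs1 hsub L q q' x y R hq hq' hR hRs hRL hk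
    have hsqrt : Real.sqrt b = C₁ / (R : ℝ) ^ 4 := by
      rw [hb, Real.sqrt_sq (div_nonneg hC₁ (pow_nonneg (Nat.cast_nonneg _) _))]
    have key := H2 β hβ₂ L R b hR hRL hb0 hpairs (m + 2) q x hq (by omega) hsep
    calc |torusE G r β L (fun U => ∏ i, (plane G r (q i) (x i) U - torusE G r β L (plane G r (q i) (x i))))|
        ≤ (C₂ * ((m + 2 : ℕ) : ℝ) ^ θ * Real.sqrt b) ^ (m + 2) := key
      _ = (C₂ * C₁ * ((m + 2 : ℕ) : ℝ) ^ θ / (R : ℝ) ^ 4) ^ (m + 2) := by rw [hsqrt]; ring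

end Summit.QuantumFields.YangMills.Theses.SquareRootCeilings
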